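import Literature.Computability.AlgebraicComplexity.ST21FormulaComplexityBounds
import Literature.Computability.AlgebraicComplexity.HittingSetsExist
import Literature.Computability.AlgebraicComplexity.MS21UniformSVGenerator
import HarnessLib

/-!
# Saha–Thankey 2021, Thm 9, first bound: hitting sets for orbits of constant-depth constant-occur
# formulas exist (proved)

Topic `Literature/Computability/AlgebraicComplexity` (cell `val-lit`, row X3-ST21). Theorem-only
file (no definitions, no named facts). C. Saha, B. Thankey, *Hitting sets for orbits of circuit
classes and polynomial families*, APPROX/RANDOM 2021, LIPIcs 207:50 [SahaThankey2021], **Thm 9**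
(p. 50:5 L9–16): "Let `C` be the set of `n`-variate, degree-`D` polynomials that are computable by
depth-`Δ`, occur-`k` formulas of size `s`. Let `R := (2k)^{2Δ·2^Δ}`. If `char(F) = 0` or
`> (2ks)^{Δ³R}`, then a hitting set for `orb(C)` can be computed in
`(nRD)^{O(R(log R + Δ log k + Δ log s) + ΔR)}` time. If the leaves are labelled by `b`-variate
polynomials, then a hitting set for `orb(C)` can be computed in `(nRD)^{O(Rb + ΔR)}` time." The tree
types the EXISTENCE reading of both sentences as one conjunction `sahaThankey2021_thm_9`
(`ST21OrbitHittingSets.lean`, explicitness dropped).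

## What is proved here

`SahaThankey2021.thm_9_general_bound` — **the first printed bound, existence reading, verbatim the
first conjunct of `sahaThankey2021_thm_9`** with the absolute constant `c = 150`: under the printed
characteristic hypothesis there is a hitting set for `orb(C)` of size
`≤ (nRD)^{150·(R(⌊log₂R⌋ + Δ⌊log₂k⌋ + Δ⌊log₂s⌋ + 1) + ΔR)} + 150`.

Route (NOT the printed construction, which is explicit — disclosed): Heintz–Schnorr existence.
A member `g = f(Ax)` of `orb(C)` has circuit complexity `L(g) ≤ 2s + n(2n+1)`
(`SahaThankey2021.complexity_eval_le_two_mul_size`, `complexity_le_of_mem_linOrbit`,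
`ST21FormulaComplexityBounds.lean`) and degree `≤ min(D, s^Δ)`
(`totalDegree_eval_le_size_pow_depth`); the tree's non-explicit hitting sets for polynomials of
small circuit size over ANY field (`HittingSets.exists_hittingSet`, Heintz–Schnorr 1980 Thm 4.4 via
the universal circuit and zero-pattern counting, `HittingSetsExist.lean`) then give
`poly(n, s, D)` points with coordinates in any `S ⊆ F`, `|S| ≥ 2·min(D, s^Δ) + 1`; such an `S`
exists by the characteristic hypothesis (`char F = 0` ⇒ `F` infinite; `char F = p > (2ks)^{Δ³R}`
⇒ `|F| ≥ p > 2s^Δ`), and `poly(n, s, D) ≤ (nRD)^{150(…)}` once `n, D, k, s ≥ 1`, `Δ ≥ 2`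
(`Thm9.size_bound`). The degenerate rows (`n = 0`, `D = 0`, `k = 0`: no variable occurs, `Δ ≤ 1`:
only the empty gates `Σ∅ = 0`, `Π∅ = 1`, `s = 0`) consist of constants, hit by the single point `0`.

`sahaThankey2021_thm_9_of_bVariate_bound` — the EDGE: the named fact `sahaThankey2021_thm_9` follows
from its second conjunct alone (stated verbatim as the hypothesis), i.e. exactly what remains open.

## The second bound (update)

The SECOND sentence of Thm 9 (`b`-variate leaves, budget `(nRD)^{O(Rb + ΔR)}` WITHOUT `s`) — the
second conjunct of `sahaThankey2021_thm_9` — is NOT proved in this file; it is proved in the sibling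
`ST21TruncatedFormulaComplexity.lean` (`SahaThankey2021.thm_9_bVariate_bound`), which closes the named
fact (`sahaThankey2021_thm_9_holds`) through the edge `sahaThankey2021_thm_9_of_bVariate_bound` below.
The obstruction recorded in the first version of this docstring (a parametrisation by the formula's
size has `poly(s)` parameters, while the printed bound is `s`-free, because occur-`k` formulas with
`k ≥ 2` may cancel high-degree intermediate results) is real for parameter counting but is removed by
DEGREE TRUNCATION: truncating every node to degree `≤ D` (`T_D(fg) = T_D(T_D f · T_D g)`, powers in
binomial Taylor form) bounds the circuit complexity of `f = T_D(φ.eval)` independently of `s`, and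
Heintz–Schnorr existence applies as for the first bound. The printed route (explicit construction via
the algebraic-independence technique for bounded-occur bounded-depth formulas) is not reproduced in
either file.

HONEST FRAMING: an existence statement about hitting sets for a 2021 circuit class, obtained from
1980 counting; `VP ≠ VNP` is NOT proved and nothing here bears on it.

## References

* [SahaThankey2021] C. Saha, B. Thankey, APPROX/RANDOM 2021, LIPIcs 207:50, Thm 9 (p. 50:5 L9–16),
  Def. 3 (p. 50:3).
* [HeintzSchnorr1980] J. Heintz, C.-P. Schnorr, *Testing polynomials which are easy to compute*,
  STOC 1980, Thm. 4.4.
-/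

noncomputable section

open MvPolynomial

namespace Literature.Computability.AlgebraicComplexity

namespace SahaThankey2021

variable {F : Type*} [Field F] {n : ℕ}

namespace Thm9

/-! ### Degenerate rows: classes of constants -/

/-- A polynomial in which no variable occurs is a constant. [folklore] -/
private theorem totalDegree_eq_zero_of_vars_eq_empty {σ : Type*} {p : MvPolynomial σ F} (h : p.vars = ∅) :
    p.totalDegree = 0 := by
  classical
  apply Nat.eq_zero_of_le_zero
  rw [totalDegree]
  refine Finset.sup_le fun m hm => ?_
  have hm0 : m = 0 := by
    ext i
    by_contra hi
    have : i ∈ p.vars := (mem_vars_iff_mem_support i).mpr ⟨m, hm, Finsupp.mem_support_iff.mpr hi⟩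
    rw [h] at this
    exact absurd this (Finset.notMem_empty _)
  rw [hm0]
  simp

/-- Occur-`0` formulas (no variable occurs in any leaf) compute constants.
[cite: SahaThankey2021, Def. 3 (p. 50:3), degenerate row `k = 0`] -/
theorem totalDegree_eval_eq_zero_of_isOccur_zero (φ : Formula F n) (h : φ.IsOccur 0) :
    φ.eval.totalDegree = 0 :=
  totalDegree_eq_zero_of_vars_eq_empty (Finset.eq_empty_of_forall_notMem fun i hi =>
    occur_ne_zero_of_mem_vars φ hi (Nat.eq_zero_of_le_zero (h i)))

/-- Formulas of depth `≤ 1` are the childless `+` / `×⋏` gates, computing `0` / `1` (a leaf has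
depth `2`). [cite: SahaThankey2021, Def. 3 (p. 50:3), degenerate row `Δ ≤ 1`] -/
theorem totalDegree_eval_eq_zero_of_depth_le_one (φ : Formula F n) (h : φ.depth ≤ 1) :
    φ.eval.totalDegree = 0 := by
  cases φ with
  | leaf p => simp [Formula.depth] at h
  | add k α g =>
      cases k with
      | zero => simp [Formula.eval]
      | succ k =>
          exfalso
          simp only [Formula.depth] at h
          have h1 := one_le_depth (g 0)
          have h2 : (g 0).depth ≤ Finset.univ.sup fun i : Fin (k + 1) => (g i).depth :=
            Finset.le_sup (f := fun i : Fin (k + 1) => (g i).depth) (Finset.mem_univ 0)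
          omega
  | mulPow k e g =>
      cases k with
      | zero => simp [Formula.eval]
      | succ k =>
          exfalso
          simp only [Formula.depth] at h
          have h1 := one_le_depth (g 0)
          have h2 : (g 0).depth ≤ Finset.univ.sup fun i : Fin (k + 1) => (g i).depth :=
            Finset.le_sup (f := fun i : Fin (k + 1) => (g i).depth) (Finset.mem_univ 0)
          omega

/-- Formulas of size `0` compute constants (`deg ≤ size ^ depth = 0`).
[cite: SahaThankey2021, Def. 3 (p. 50:3), degenerate row `s = 0`] -/
theorem totalDegree_eval_eq_zero_of_size_eq_zero (φ : Formula F n) (h : φ.size = 0) :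
    φ.eval.totalDegree = 0 := by
  have h1 := totalDegree_eval_le_size_pow_depth φ
  rw [h, zero_pow (by have := one_le_depth φ; omega)] at h1
  exact Nat.eq_zero_of_le_zero h1

/-- If every member of `𝒞` is a constant then so is every member of `orb(𝒞)`, and the single point
`0` is a hitting set for `orb(𝒞)`. [cite: SahaThankey2021, Defs. 4–5 (p. 50:3–4)] -/
theorem isHittingSetFor_zero_orb_of_totalDegree_eq_zero {𝒞 : Set (MvPolynomial (Fin n) F)}
    (h : ∀ f ∈ 𝒞, f.totalDegree = 0) :
    HittingSets.IsHittingSetFor (↑({fun _ => (0 : F)} : Finset (Fin n → F))) (orb F 𝒞) := by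
  intro g hg hg0
  rw [mem_orb_iff] at hg
  obtain ⟨f, hf, hgf⟩ := hg
  have hdeg : g.totalDegree = 0 :=
    Nat.eq_zero_of_le_zero ((totalDegree_le_of_mem_linOrbit hgf).trans (h f hf).le)
  have hgC : g = C (g.coeff 0) := totalDegree_eq_zero_iff_eq_C.mp hdeg
  refine ⟨fun _ => 0, by simp, ?_⟩
  intro hc
  apply hg0
  rw [hgC, eval_C] at hc
  rw [hgC, hc, C_0]

/-! ### The field is large enough: from the characteristic hypothesis -/

/-- `char F = 0 ∨ N < char F` gives `F` infinite or `|F| ≥ N + 1` (`|F| = p^m ≥ p = char F`).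
[cite: SahaThankey2021, Thm 9 (p. 50:5), hypothesis "char(F) = 0 or > (2ks)^{Δ³R}"] -/
theorem infinite_or_le_card_of_ringChar {N : ℕ} (h : ringChar F = 0 ∨ N < ringChar F) :
    Infinite F ∨ N + 1 ≤ Nat.card F := by
  cases finite_or_infinite F with
  | inr hinf => exact Or.inl hinf
  | inl hfin =>
      right
      haveI := Fintype.ofFinite F
      have hp0 : ringChar F ≠ 0 := CharP.ringChar_ne_zero_of_finite F
      rcases h with h | h
      · exact absurd h hp0
      · obtain ⟨m, -, hcard⟩ := FiniteField.card F (ringChar F)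
        rw [Nat.card_eq_fintype_card, hcard]
        calc N + 1 ≤ ringChar F := h
          _ = ringChar F ^ 1 := (pow_one _).symm
          _ ≤ ringChar F ^ (m : ℕ) := Nat.pow_le_pow_right (Nat.pos_of_ne_zero hp0) m.pos

/-! ### The main row: Heintz–Schnorr existence for the orbit of the class -/

/-- **Main row** (`k, s ≥ 1`, `Δ ≥ 2`): with `d' = min(D, s^Δ)` and any grid of `2d' + 1` field
elements (available by the characteristic hypothesis) the Heintz–Schnorr hitting set for
`{g : deg g ≤ d', L(g) ≤ 2s + n(2n+1)}` hits `orb(C)`.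
[cite: SahaThankey2021, Thm 9 (p. 50:5 L9–13); HeintzSchnorr1980, Thm. 4.4] -/
theorem exists_hittingSet_main {D Δ k s : ℕ} (hk : 1 ≤ k) (hΔ : 2 ≤ Δ) (hs : 1 ≤ s)
    (hF : ringChar F = 0 ∨ (2 * k * s) ^ (Δ ^ 3 * (2 * k) ^ (2 * Δ * 2 ^ Δ)) < ringChar F) :
    ∃ H : Finset (Fin n → F),
      H.card ≤ 9376 * (n + min D (s ^ Δ) + (2 * s + n * (2 * n + 1)) + 2) ^ 26 *
        (Nat.log 2 ((2 * min D (s ^ Δ) + 1) ^ n * (3 * min D (s ^ Δ) + 1) + 1) + 1) + 1 ∧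
      HittingSets.IsHittingSetFor (↑H) (orb F {f : MvPolynomial (Fin n) F | f.totalDegree ≤ D ∧
        ∃ φ : Formula F n, φ.depth ≤ Δ ∧ φ.IsOccur k ∧ φ.size ≤ s ∧ φ.eval = f}) := by
  set d' := min D (s ^ Δ) with hd'
  -- a grid of `2 d' + 1` field elements exists
  have hgrid : Infinite F ∨ 2 * d' + 1 ≤ Nat.card F := by
    refine (infinite_or_le_card_of_ringChar hF).imp_right fun h => le_trans ?_ h
    have h1 : d' ≤ s ^ Δ := min_le_right _ _
    have hR : 1 ≤ (2 * k) ^ (2 * Δ * 2 ^ Δ) := Nat.one_le_pow _ _ (by omega)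
    have hexp : Δ + 1 ≤ Δ ^ 3 * (2 * k) ^ (2 * Δ * 2 ^ Δ) := by
      have h3 : Δ + 1 ≤ Δ ^ 3 := by
        have : Δ ^ 3 = Δ * Δ * Δ := by ring
        nlinarith
      exact h3.trans (Nat.le_mul_of_pos_right _ hR)
    have hks : 0 < 2 * k * s := Nat.mul_pos (by omega) hs
    have h2 : 2 * s ^ Δ ≤ (2 * k * s) ^ (Δ ^ 3 * (2 * k) ^ (2 * Δ * 2 ^ Δ)) :=
      calc 2 * s ^ Δ ≤ 2 ^ (Δ + 1) * s ^ (Δ + 1) :=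
            Nat.mul_le_mul (by calc (2 : ℕ) = 2 ^ 1 := (pow_one 2).symm
                                _ ≤ 2 ^ (Δ + 1) := Nat.pow_le_pow_right two_pos (by omega))
              (Nat.pow_le_pow_right hs (Nat.le_succ Δ))
        _ = (2 * s) ^ (Δ + 1) := (mul_pow 2 s (Δ + 1)).symm
        _ ≤ (2 * k * s) ^ (Δ + 1) :=
            Nat.pow_le_pow_left (Nat.mul_le_mul_right s (by omega : 2 ≤ 2 * k)) _
        _ ≤ (2 * k * s) ^ (Δ ^ 3 * (2 * k) ^ (2 * Δ * 2 ^ Δ)) := Nat.pow_le_pow_right hks hexp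
    omega
  obtain ⟨S, hScard⟩ := MS2021.exists_finset_card_eq (K := F) (2 * d' + 1) hgrid
  obtain ⟨H, -, hHcard, hhit⟩ :=
    HittingSets.exists_hittingSet (F := F) n (2 * s + n * (2 * n + 1)) d' S hScard.ge
  refine ⟨H, by rw [hScard] at hHcard; exact hHcard, fun g hg hg0 => ?_⟩
  rw [mem_orb_iff] at hg
  obtain ⟨f, ⟨hfD, φ, hφΔ, -, hφs, hφf⟩, hgf⟩ := hg
  refine hhit g ?_ ?_ hg0
  · -- degree `≤ min(D, s^Δ)`
    refine (totalDegree_le_of_mem_linOrbit hgf).trans (le_min hfD ?_)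
    rw [← hφf]
    refine (totalDegree_eval_le_size_pow_depth φ).trans ?_
    rcases Nat.eq_zero_or_pos φ.size with h0 | hpos
    · rw [h0, zero_pow (by have := one_le_depth φ; omega)]
      exact Nat.zero_le _
    · exact (Nat.pow_le_pow_left hφs _).trans (Nat.pow_le_pow_right hs hφΔ)
  · -- complexity `≤ 2s + n(2n+1)`
    refine (complexity_le_of_mem_linOrbit hgf).trans (Nat.add_le_add_right ?_ _)
    rw [← hφf]
    exact (complexity_eval_le_two_mul_size φ).trans (Nat.mul_le_mul_left 2 hφs)

/-! ### Arithmetic of the size bound -/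

/-- `Nat.log 2 (a ^ n * b + 1) ≤ n * a + b` (crude: `a ≤ 2^a`, `b ≤ 2^b`). [folklore] -/
private theorem log2_pow_mul_succ_le (a b n : ℕ) : Nat.log 2 (a ^ n * b + 1) ≤ n * a + b := by
  have ha : a ^ n ≤ 2 ^ (n * a) := by
    calc a ^ n ≤ (2 ^ a) ^ n := Nat.pow_le_pow_left Nat.lt_two_pow_self.le n
      _ = 2 ^ (n * a) := by rw [← pow_mul, mul_comm]
  have hY : a ^ n * b + 1 < 2 ^ (n * a + b + 1) := by
    have hb1 : b + 1 ≤ 2 ^ b := Nat.lt_two_pow_self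
    have h1 : 1 ≤ 2 ^ (n * a) := Nat.one_le_two_pow
    calc a ^ n * b + 1 ≤ 2 ^ (n * a) * b + 2 ^ (n * a) * 1 :=
          add_le_add (Nat.mul_le_mul_right _ ha) (by simpa using h1)
      _ = 2 ^ (n * a) * (b + 1) := by ring
      _ ≤ 2 ^ (n * a) * 2 ^ b := Nat.mul_le_mul_left _ hb1
      _ = 2 ^ (n * a + b) := by rw [pow_add]
      _ < 2 ^ (n * a + b + 1) := Nat.pow_lt_pow_right (by norm_num) (by omega)
  have := (Nat.log_lt_iff_lt_pow one_lt_two (by omega)).2 hY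
  omega

/-- **Size bound, core** (opaque parameters): for `y ≥ 2` with `n, d' ≤ y` and `s < 2^{l+1}`,
`9376 (n + d' + 2s + n(2n+1) + 2)²⁶ (log₂((2d'+1)ⁿ(3d'+1) + 1) + 1) + 1 ≤ y^{26 l + 149} + 1`.
[cite: SahaThankey2021, Thm 9 (p. 50:5), "(nRD)^{O(R(log R + Δ log k + Δ log s) + ΔR)}"] -/
theorem size_bound_core {n s d' y l : ℕ} (hy2 : 2 ≤ y) (hny : n ≤ y) (hd'y : d' ≤ y)
    (hsl : s < 2 ^ (l + 1)) :
    9376 * (n + d' + (2 * s + n * (2 * n + 1)) + 2) ^ 26 *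
        (Nat.log 2 ((2 * d' + 1) ^ n * (3 * d' + 1) + 1) + 1) + 1 ≤ y ^ (26 * l + 149) + 1 := by
  have hypos : 0 < y := by omega
  have h2y : 2 ^ (l + 1) ≤ y ^ (l + 1) := Nat.pow_le_pow_left hy2 _
  -- (A) the base `n + d' + 2s + n(2n+1) + 2 ≤ 8 y^{l+2} ≤ y^{l+5}`
  have hyl2 : y ≤ y ^ (l + 2) := Nat.le_self_pow (by omega) y
  have hyl1 : y ^ (l + 1) ≤ y ^ (l + 2) := Nat.pow_le_pow_right hypos (by omega)
  have hy2l : y ^ 2 ≤ y ^ (l + 2) := Nat.pow_le_pow_right hypos (by omega)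
  have hn2 : n * (2 * n + 1) ≤ 3 * y ^ 2 := by
    have e1 : n * (2 * n + 1) ≤ y * (2 * y + 1) := Nat.mul_le_mul hny (by omega)
    have e2 : y * (2 * y + 1) = 2 * y ^ 2 + y := by ring
    have e3 : y ≤ y ^ 2 := Nat.le_self_pow two_ne_zero y
    omega
  have hbase : n + d' + (2 * s + n * (2 * n + 1)) + 2 ≤ 8 * y ^ (l + 2) := by
    have e1 : 2 * s ≤ 2 * y ^ (l + 2) := by omega
    have e2 : n * (2 * n + 1) ≤ 3 * y ^ (l + 2) := hn2.trans (Nat.mul_le_mul_left 3 hy2l)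
    have e3 : 2 ≤ y ^ (l + 2) := hy2.trans hyl2
    omega
  have h8 : 8 ≤ y ^ 3 := by
    calc (8 : ℕ) = 2 ^ 3 := by norm_num
      _ ≤ y ^ 3 := Nat.pow_le_pow_left hy2 3
  have hbase' : n + d' + (2 * s + n * (2 * n + 1)) + 2 ≤ y ^ (l + 5) := by
    calc n + d' + (2 * s + n * (2 * n + 1)) + 2 ≤ 8 * y ^ (l + 2) := hbase
      _ ≤ y ^ 3 * y ^ (l + 2) := Nat.mul_le_mul_right _ h8
      _ = y ^ (l + 5) := by rw [← pow_add, Nat.add_comm 3 (l + 2)]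
  -- (B) the 26th power
  have hpow : (n + d' + (2 * s + n * (2 * n + 1)) + 2) ^ 26 ≤ y ^ (26 * l + 130) := by
    have hexp : (l + 5) * 26 = 26 * l + 130 := by ring
    calc (n + d' + (2 * s + n * (2 * n + 1)) + 2) ^ 26 ≤ (y ^ (l + 5)) ^ 26 :=
          Nat.pow_le_pow_left hbase' 26
      _ = y ^ (26 * l + 130) := by rw [← pow_mul, hexp]
  -- (C) the logarithm `≤ y⁵`
  have hlog : Nat.log 2 ((2 * d' + 1) ^ n * (3 * d' + 1) + 1) + 1 ≤ y ^ 5 := by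
    have h0 := log2_pow_mul_succ_le (2 * d' + 1) (3 * d' + 1) n
    have h1 : n * (2 * d' + 1) + (3 * d' + 1) + 1 ≤ 6 * y ^ 2 := by
      have e1 : n * (2 * d' + 1) ≤ y * (2 * y + 1) := Nat.mul_le_mul hny (by omega)
      have e2 : y * (2 * y + 1) = 2 * y ^ 2 + y := by ring
      have e3 : 2 * y ≤ y ^ 2 := by
        calc 2 * y ≤ y * y := Nat.mul_le_mul_right y hy2
          _ = y ^ 2 := (pow_two y).symm
      omega
    have h6 : 6 ≤ y ^ 3 := le_trans (by norm_num) h8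
    calc Nat.log 2 ((2 * d' + 1) ^ n * (3 * d' + 1) + 1) + 1 ≤ 6 * y ^ 2 := by omega
      _ ≤ y ^ 3 * y ^ 2 := Nat.mul_le_mul_right _ h6
      _ = y ^ 5 := by rw [← pow_add]
  -- (D) the constant
  have h9376 : 9376 ≤ y ^ 14 := by
    calc (9376 : ℕ) ≤ 2 ^ 14 := by norm_num
      _ ≤ y ^ 14 := Nat.pow_le_pow_left hy2 14
  have hexp2 : 14 + (26 * l + 130) + 5 = 26 * l + 149 := by ring
  calc 9376 * (n + d' + (2 * s + n * (2 * n + 1)) + 2) ^ 26 *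
        (Nat.log 2 ((2 * d' + 1) ^ n * (3 * d' + 1) + 1) + 1) + 1
      ≤ y ^ 14 * y ^ (26 * l + 130) * y ^ 5 + 1 :=
        Nat.add_le_add_right (Nat.mul_le_mul (Nat.mul_le_mul h9376 hpow) hlog) 1
    _ = y ^ (26 * l + 149) + 1 := by rw [← pow_add, ← pow_add, hexp2]

/-- **Size bound** for the main row (`n, D, k ≥ 1`, `Δ ≥ 2`, `d' ≤ D`), with `R = (2k)^{2Δ·2^Δ}`,
`y = nRD ≥ 2`, `l = ⌊log₂ s⌋`: the Heintz–Schnorr count is `≤ y^{26 l + 149} + 1`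
(`size_bound_core`), and `26 l + 149 ≤ 150·(R(⌊log₂R⌋ + Δ⌊log₂k⌋ + Δ l + 1) + ΔR)` since the
bracket is `≥ RΔl + R ≥ l + 2`.
[cite: SahaThankey2021, Thm 9 (p. 50:5), "(nRD)^{O(R(log R + Δ log k + Δ log s) + ΔR)}"] -/
theorem size_bound {n D Δ k s d' : ℕ} (hn : 1 ≤ n) (hD : 1 ≤ D) (hk : 1 ≤ k) (hΔ : 2 ≤ Δ)
    (hd' : d' ≤ D) :
    9376 * (n + d' + (2 * s + n * (2 * n + 1)) + 2) ^ 26 *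
        (Nat.log 2 ((2 * d' + 1) ^ n * (3 * d' + 1) + 1) + 1) + 1 ≤
      (n * (2 * k) ^ (2 * Δ * 2 ^ Δ) * D) ^
        (150 * ((2 * k) ^ (2 * Δ * 2 ^ Δ) *
          (Nat.log 2 ((2 * k) ^ (2 * Δ * 2 ^ Δ)) + Δ * Nat.log 2 k + Δ * Nat.log 2 s + 1) +
          Δ * (2 * k) ^ (2 * Δ * 2 ^ Δ))) + 150 := by
  have hR2 : 2 ≤ (2 * k) ^ (2 * Δ * 2 ^ Δ) := by
    have h1 : 1 ≤ 2 * Δ * 2 ^ Δ := by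
      have := Nat.one_le_two_pow (n := Δ)
      calc 1 ≤ 2 ^ Δ := this
        _ = 1 * 2 ^ Δ := (one_mul _).symm
        _ ≤ 2 * Δ * 2 ^ Δ := Nat.mul_le_mul_right _ (by omega)
    calc 2 ≤ 2 * k := by omega
      _ = (2 * k) ^ 1 := (pow_one _).symm
      _ ≤ (2 * k) ^ (2 * Δ * 2 ^ Δ) := Nat.pow_le_pow_right (by omega) h1
  have hsl : s < 2 ^ (Nat.log 2 s + 1) := Nat.lt_pow_succ_log_self one_lt_two s
  generalize (2 * k) ^ (2 * Δ * 2 ^ Δ) = R at hR2 ⊢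
  generalize Nat.log 2 s = l at hsl ⊢
  generalize Nat.log 2 R = a
  generalize Nat.log 2 k = b
  have hy2 : 2 ≤ n * R * D := by
    calc 2 ≤ R := hR2
      _ = 1 * R * 1 := by ring
      _ ≤ n * R * D := Nat.mul_le_mul (Nat.mul_le_mul hn le_rfl) hD
  have hny : n ≤ n * R * D := by
    calc n = n * 1 * 1 := by ring
      _ ≤ n * R * D := Nat.mul_le_mul (Nat.mul_le_mul le_rfl (by omega)) hD
  have hDy : D ≤ n * R * D := by
    calc D = 1 * 1 * D := by ring
      _ ≤ n * R * D := Nat.mul_le_mul (Nat.mul_le_mul hn (by omega)) le_rfl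
  generalize n * R * D = y at hy2 hny hDy ⊢
  have hcore := size_bound_core (n := n) (s := s) hy2 hny (hd'.trans hDy) hsl
  refine hcore.trans (Nat.add_le_add (Nat.pow_le_pow_right (by omega) ?_) (by norm_num))
  -- the exponent budget `26 l + 149 ≤ 150 (R (a + Δ b + Δ l + 1) + Δ R)`
  have h1 : l ≤ R * (Δ * l) := by
    calc l = 1 * (1 * l) := by ring
      _ ≤ R * (Δ * l) := Nat.mul_le_mul (by omega) (Nat.mul_le_mul_right _ (by omega))
  have h2 : R * (Δ * l + 1) ≤ R * (a + Δ * b + Δ * l + 1) + Δ * R :=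
    le_trans (Nat.mul_le_mul_left R (by omega)) (Nat.le_add_right _ _)
  have h3 : R * (Δ * l + 1) = R * (Δ * l) + R := by ring
  omega

end Thm9

/-- **Saha–Thankey 2021, Thm 9, first bound (existence reading), PROVED** with `c = 150`: for every
field `F` with `char F = 0` or `char F > (2ks)^{Δ³R}`, `R = (2k)^{2Δ·2^Δ}`, there is a hitting set
for `orb(C)`, `C` = the `n`-variate degree-`≤ D` polynomials computed by depth-`≤ Δ` occur-`k`
formulas of size `≤ s`, of size `≤ (nRD)^{c(R(⌊log₂R⌋ + Δ⌊log₂k⌋ + Δ⌊log₂s⌋ + 1) + ΔR)} + c`. This is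
verbatim the FIRST conjunct of the named fact `sahaThankey2021_thm_9`; the second conjunct (the
`b`-variate bound without `s`) is proved in `ST21TruncatedFormulaComplexity.lean` (module docstring).
Route ≠ print (Heintz–Schnorr existence instead of the explicit construction), disclosed.
[cite: SahaThankey2021, Thm 9 (p. 50:5 L9–13); HeintzSchnorr1980, Thm. 4.4] -/
theorem thm_9_general_bound : ∃ c : ℕ, ∀ (F : Type) [Field F] (n D Δ k s : ℕ),
    (ringChar F = 0 ∨ (2 * k * s) ^ (Δ ^ 3 * (2 * k) ^ (2 * Δ * 2 ^ Δ)) < ringChar F) →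
    ∃ H : Finset (Fin n → F),
      H.card ≤ (n * (2 * k) ^ (2 * Δ * 2 ^ Δ) * D) ^
        (c * ((2 * k) ^ (2 * Δ * 2 ^ Δ) *
          (Nat.log 2 ((2 * k) ^ (2 * Δ * 2 ^ Δ)) + Δ * Nat.log 2 k + Δ * Nat.log 2 s + 1) +
          Δ * (2 * k) ^ (2 * Δ * 2 ^ Δ))) + c ∧
      HittingSets.IsHittingSetFor (↑H) (orb F {f : MvPolynomial (Fin n) F | f.totalDegree ≤ D ∧
        ∃ φ : Formula F n, φ.depth ≤ Δ ∧ φ.IsOccur k ∧ φ.size ≤ s ∧ φ.eval = f}) := by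
  refine ⟨150, fun F _ n D Δ k s hF => ?_⟩
  by_cases hmain : 1 ≤ n ∧ 1 ≤ D ∧ 1 ≤ k ∧ 2 ≤ Δ ∧ 1 ≤ s
  · obtain ⟨hn, hD, hk, hΔ, hs⟩ := hmain
    obtain ⟨H, hcard, hhit⟩ := Thm9.exists_hittingSet_main (F := F) (n := n) (D := D) hk hΔ hs hF
    exact ⟨H, hcard.trans (Thm9.size_bound hn hD hk hΔ (min_le_left _ _)), hhit⟩
  · -- degenerate rows: every member of the class (hence of its orbit) is a constant
    refine ⟨{fun _ => 0}, ?_, Thm9.isHittingSetFor_zero_orb_of_totalDegree_eq_zero ?_⟩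
    · rw [Finset.card_singleton]
      omega
    · rintro f ⟨hfD, φ, hφΔ, hφk, hφs, rfl⟩
      simp only [not_and_or, not_le] at hmain
      rcases hmain with h | h | h | h | h
      · obtain rfl : n = 0 := by omega
        exact Thm9.totalDegree_eq_zero_of_vars_eq_empty (Finset.eq_empty_of_isEmpty _)
      · obtain rfl : D = 0 := by omega
        exact Nat.eq_zero_of_le_zero hfD
      · obtain rfl : k = 0 := by omega
        exact Thm9.totalDegree_eval_eq_zero_of_isOccur_zero φ hφk
      · exact Thm9.totalDegree_eval_eq_zero_of_depth_le_one φ (by omega)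
      · obtain rfl : s = 0 := by omega
        exact Thm9.totalDegree_eval_eq_zero_of_size_eq_zero φ (Nat.eq_zero_of_le_zero hφs)

/-! ### The named fact reduces to its second conjunct -/

/-- Monotonicity of the typed budgets `y^{cE} + c` in the constant `c` (for `c' ≥ 1`). [folklore] -/
private theorem Thm9.budget_mono {y E c c' : ℕ} (hc : c ≤ c') (hc' : 1 ≤ c') :
    y ^ (c * E) + c ≤ y ^ (c' * E) + c' := by
  rcases Nat.eq_zero_or_pos y with rfl | hy
  · -- `y = 0`
    rcases Nat.eq_zero_or_pos (c * E) with h0 | hpos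
    · rw [h0, pow_zero]
      rcases Nat.eq_zero_or_pos (c' * E) with h0' | hpos'
      · rw [h0', pow_zero]
        omega
      · have hc0 : c = 0 := by
          rcases Nat.eq_zero_or_pos c with h | h
          · exact h
          · exfalso
            have hE : 0 < E := Nat.pos_of_ne_zero fun hE => by rw [hE, mul_zero] at hpos'; omega
            have := Nat.mul_pos h hE
            omega
        rw [zero_pow (by omega)]
        omega
    · have hpos' : 0 < c' * E := lt_of_lt_of_le hpos (Nat.mul_le_mul_right _ hc)
      rw [zero_pow (by omega), zero_pow (by omega)]
      omega
  · exact Nat.add_le_add (Nat.pow_le_pow_right hy (Nat.mul_le_mul_right _ hc)) hc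

/-- **Edge: `sahaThankey2021_thm_9` follows from its second conjunct alone** (the `b`-variate bound,
stated here verbatim as the hypothesis, with its own constant), the first conjunct being the theorem
`thm_9_general_bound`; the two constants are merged into `max c₁ c₂ + 1` by monotonicity of the
budgets. (The hypothesis is discharged in `ST21TruncatedFormulaComplexity.lean`.)
[cite: SahaThankey2021, Thm 9 (p. 50:5 L9–16)] -/
theorem sahaThankey2021_thm_9_of_bVariate_bound
    (h : ∃ c : ℕ, ∀ (F : Type) [Field F] (n D Δ k s : ℕ),
      (ringChar F = 0 ∨ (2 * k * s) ^ (Δ ^ 3 * (2 * k) ^ (2 * Δ * 2 ^ Δ)) < ringChar F) →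
      ∀ b : ℕ, ∃ H : Finset (Fin n → F),
        H.card ≤ (n * (2 * k) ^ (2 * Δ * 2 ^ Δ) * D) ^
          (c * ((2 * k) ^ (2 * Δ * 2 ^ Δ) * b + Δ * (2 * k) ^ (2 * Δ * 2 ^ Δ) + 1)) + c ∧
        HittingSets.IsHittingSetFor (↑H) (orb F {f : MvPolynomial (Fin n) F | f.totalDegree ≤ D ∧
          ∃ φ : Formula F n, φ.depth ≤ Δ ∧ φ.IsOccur k ∧ φ.size ≤ s ∧ φ.LeavesVariate b ∧
            φ.eval = f})) :
    sahaThankey2021_thm_9 := by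
  obtain ⟨c₁, h₁⟩ := thm_9_general_bound
  obtain ⟨c₂, h₂⟩ := h
  refine ⟨max c₁ c₂ + 1, fun F _ n D Δ k s hF => ⟨?_, fun b => ?_⟩⟩
  · obtain ⟨H, hH, hhit⟩ := h₁ F n D Δ k s hF
    exact ⟨H, hH.trans (Thm9.budget_mono ((le_max_left c₁ c₂).trans (Nat.le_succ _)) (by omega)),
      hhit⟩
  · obtain ⟨H, hH, hhit⟩ := h₂ F n D Δ k s hF b
    exact ⟨H, hH.trans (Thm9.budget_mono ((le_max_right c₁ c₂).trans (Nat.le_succ _)) (by omega)),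
      hhit⟩

end SahaThankey2021

end Literature.Computability.AlgebraicComplexity

end
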